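import Summits.AtomisticToContinuum.Crystallization.Theorems.ExcessDecayLiouvilleHcpLiouvilleLinearEq
import Summits.AtomisticToContinuum.Crystallization.Theorems.ExcessDecayLiouvilleHcpLiouvilleCutoff

/-!
# `ExcessDecayLiouville.HcpLiouville` (stmt-AtomisticToContinuum-9332), line `Sketch`: stub `stub_levelOneGrowth`

Level 1 of the two-level Caccioppoli Liouville argument ("boundedness is smallness at infinity") for the
crux `HcpLiouville` (line `two-level-caccioppoli`, lead skeleton `Lines/Sketch.lean`).  Data: an admissible
hcp datum `(t, A)` (`Adm₀ A`, `Inner₀ t A`), a Lennard-Jones equilibrium `X` (`Equil₀ X`) in displacement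
form (`IsDisplacement X t A u`, `‖u‖ ≤ 1/40`), an anchor `τ` whose anchored two-lattice
`S* = Sites₀ (anchorDatum t τ) A` is hcp-like and in force balance, and ray-secant coercivity
`SecantCoercive ρ κ₁`, `‖τ‖ ≤ ρ`.  Conclusion: `GrowthBound t A (u − τ𝟙₁)`.

In the anchored setting of `…HcpLiouvilleLinearEq.lean` (field `v = LevelOne.vField t A τ u`, secant matrices
`B_pq(w,w') = LevelOne.secK (p − q) (v p − v q) w w'`, EXACT linear equation `Σ_q B_pq(v p − v q, ·) = 0`)
and with the cut-off `χ = LevelOne.cutoff S* c R` of `…HcpLiouvilleCutoff.lean`: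

* `LevelOne.secFormAt_eq_tsum` — the vocabulary's `secFormAt` at `v` is `Σ_p Σ_q B_pq(Dφ, Dφ)`;
* `LevelOne.row_identity` — the discrete product rule summed over a row:
  `Σ_q B_pq(D(χv), D(χv)) = −Σ_q B_pq(Dv, χ_q² v_q) + Σ_q (χ_p − χ_q)² B_pq(v_p, v_q)`;
* `LevelOne.tsum_first_part_eq_zero` — summation by parts: `Σ_p Σ_q B_pq(Dv, χ_q² v_q) = 0`;
* `LevelOne.secFormAt_cutoff_le` — the NONLINEAR CACCIOPPOLI INEQUALITY
  `secFormAt (anchorDatum t τ) A v (χ•v) ≤ (3/40)²·1984·K₀·R` (`R ≥ 1`);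
* `stub_levelOneGrowth` — coercivity (hypothesis; test field `χ•v`, finitely supported on `S*`,
  `‖v + τ𝟙₁*‖ = ‖u ∘ bwd‖ ≤ 1/40`) gives `κ₁·nnForm (anchorDatum t τ) A (χ•v) ≤ C₀R/2`, and the read-out
  `LevelOne.growth_sum_le_nnForm` (χ = 1 on `B_R(c)`, transport along `fwd`) turns the bound at radius `R + 3`
  into the `GrowthBound` double sum at radius `R`.

All `[folklore]`; a `--supports` helper for item stmt-AtomisticToContinuum-9332, nothing here closes an item.
-/

noncomputable section

namespace Summit.AtomisticToContinuum.Crystallization.Theorems.ExcessDecayLiouville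

open scoped BigOperators Topology Classical InnerProductSpace RealInnerProductSpace
open Literature.MathematicalPhysics.StatisticalMechanics
open Summit.AtomisticToContinuum.Crystallization.Theses.ExcessDecayLiouville
open Summit.AtomisticToContinuum.Crystallization.Theorems.PhononStabilityNegative

local notation "E3" => EuclideanSpace ℝ (Fin 3)

namespace LevelOne

variable {t : Fin 2 → E3} {A : E3 →L[ℝ] E3} {τ : E3} {X : Set E3} {u : E3 → E3}

/-! ## The secant form as a double sum of the secant matrices -/

/-- **`secFormAt` at `v` is `Σ_p Σ_q B_pq(φ p − φ q, φ p − φ q)`** (the diagonal terms vanish on both sides).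
[folklore] -/
theorem secFormAt_eq_tsum (hA : Adm₀ A) (hI : Inner₀ t A) (hIτ : Inner₀ (anchorDatum t τ) A)
    (hu : IsDisplacement X t A u) (φ : E3 → E3) :
    secFormAt (anchorDatum t τ) A (vField t A τ u) φ =
      ∑' p : Sites₀ (anchorDatum t τ) A, ∑' q : Sites₀ (anchorDatum t τ) A,
        secK (p - q) (vField t A τ u p - vField t A τ u q) (φ p - φ q) (φ p - φ q) := by
  unfold secFormAt
  refine tsum_congr fun p => tsum_congr fun q => ?_
  by_cases hpq : (p : E3) ≠ q
  · rw [if_pos hpq]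
    have he : (23 / 25 : ℝ) ≤ ‖(p : E3) - q‖ := by
      rw [← dist_eq_norm]; exact dist_sites_ge hA hIτ p.2 q.2 hpq
    exact (secK_self ((norm_vField_sub_le hA hI hIτ hu p.2 q.2).trans_lt (by linarith)) _).symm
  · rw [if_neg hpq]
    push Not at hpq
    simp only [hpq, sub_self, secK_zero_bond]

/-! ## Summability book-keeping -/

/-- `‖χ_q² • v_q‖ ≤ 3/40`. [folklore] -/
theorem norm_sq_cutoff_smul_le (hA : Adm₀ A) (hI : Inner₀ t A) (hIτ : Inner₀ (anchorDatum t τ) A)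
    (hu : IsDisplacement X t A u) (c : E3) (R : ℝ) (q : Sites₀ (anchorDatum t τ) A) :
    ‖cutoff (Sites₀ (anchorDatum t τ) A) c R q ^ 2 • vField t A τ u q‖ ≤ 3 / 40 := by
  rw [norm_smul, Real.norm_eq_abs, abs_of_nonneg (sq_nonneg _)]
  have h0 := cutoff_nonneg (Sites₀ (anchorDatum t τ) A) c R q
  have h1 := cutoff_le_one (Sites₀ (anchorDatum t τ) A) c R q
  have h2 := norm_vField_le hA hI hIτ hu q.2
  have h3 : cutoff (Sites₀ (anchorDatum t τ) A) c R q ^ 2 ≤ 1 := by nlinarith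
  calc cutoff (Sites₀ (anchorDatum t τ) A) c R q ^ 2 * ‖vField t A τ u q‖ ≤ 1 * (3 / 40) :=
      mul_le_mul h3 h2 (norm_nonneg _) zero_le_one
    _ = 3 / 40 := one_mul _

/-- The column family `p ↦ B_pq(v p − v q, χ_q² v_q)` is summable (antisymmetry + row summability at `q`).
[folklore] -/
theorem summable_first_col (hA : Adm₀ A) (hI : Inner₀ t A) (hIτ : Inner₀ (anchorDatum t τ) A)
    (hu : IsDisplacement X t A u) (c : E3) (R : ℝ) (q : Sites₀ (anchorDatum t τ) A) :
    Summable fun p : Sites₀ (anchorDatum t τ) A =>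
      secK (p - q) (vField t A τ u p - vField t A τ u q) (vField t A τ u p - vField t A τ u q)
        (cutoff (Sites₀ (anchorDatum t τ) A) c R q ^ 2 • vField t A τ u q) := by
  have h := (summable_row hA hI hIτ hu q.2 (fun p => vField t A τ u q - vField t A τ u p)
    (fun _ => cutoff (Sites₀ (anchorDatum t τ) A) c R q ^ 2 • vField t A τ u q)
    (fun p => norm_vField_sub_le hA hI hIτ hu q.2 p.2)
    (fun _ => norm_sq_cutoff_smul_le hA hI hIτ hu c R q)).neg
  refine h.congr fun p => ?_
  rw [B_antisymm (vField t A τ u) p q]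

/-- Rows of the first part are finite sums over the sites of `B_{2R}(c)`. [folklore] -/
theorem first_row_eq_sum (hA : Adm₀ A) (hIτ : Inner₀ (anchorDatum t τ) A) (c : E3) {R : ℝ} (hR : 0 < R)
    (p : Sites₀ (anchorDatum t τ) A) :
    ∑' q : Sites₀ (anchorDatum t τ) A,
        secK (p - q) (vField t A τ u p - vField t A τ u q) (vField t A τ u p - vField t A τ u q)
          (cutoff (Sites₀ (anchorDatum t τ) A) c R q ^ 2 • vField t A τ u q) =
      ∑ q ∈ (finite_sites_ball hA hIτ c (2 * R)).toFinset,
        secK (p - q) (vField t A τ u p - vField t A τ u q) (vField t A τ u p - vField t A τ u q)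
          (cutoff (Sites₀ (anchorDatum t τ) A) c R q ^ 2 • vField t A τ u q) := by
  refine tsum_eq_sum fun q hq => ?_
  have hfar : 2 * R ≤ dist (q : E3) c := by
    by_contra h
    exact hq ((Set.Finite.mem_toFinset _).2 (le_of_lt (not_le.1 h)))
  rw [cutoff_eq_zero_of_le hR hfar]
  simp

/-- **Summation by parts**: `Σ_p Σ_q B_pq(v p − v q, χ_q² v_q) = 0`. [folklore] -/
theorem tsum_first_part_eq_zero (hA : Adm₀ A) (hI : Inner₀ t A) (hIτ : Inner₀ (anchorDatum t τ) A)
    (hu : IsDisplacement X t A u) (hEX : Equil₀ X) (hEτ : Equil₀ (Sites₀ (anchorDatum t τ) A))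
    (c : E3) {R : ℝ} (hR : 0 < R) :
    ∑' p : Sites₀ (anchorDatum t τ) A, ∑' q : Sites₀ (anchorDatum t τ) A,
        secK (p - q) (vField t A τ u p - vField t A τ u q) (vField t A τ u p - vField t A τ u q)
          (cutoff (Sites₀ (anchorDatum t τ) A) c R q ^ 2 • vField t A τ u q) = 0 := by
  rw [tsum_congr (first_row_eq_sum (u := u) hA hIτ c hR)]
  rw [Summable.tsum_finsetSum fun q _ => summable_first_col hA hI hIτ hu c R q]
  refine Finset.sum_eq_zero fun q _ => ?_
  rw [tsum_congr fun p : Sites₀ (anchorDatum t τ) A => B_antisymm (vField t A τ u) (p : E3) q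
    (cutoff (Sites₀ (anchorDatum t τ) A) c R q ^ 2 • vField t A τ u q), tsum_neg,
    tsum_linear_eq hA hI hIτ hu hEX hEτ q.2, neg_zero]

/-- The first part, row by row, is a summable family of `p`. [folklore] -/
theorem summable_first_part (hA : Adm₀ A) (hI : Inner₀ t A) (hIτ : Inner₀ (anchorDatum t τ) A)
    (hu : IsDisplacement X t A u) (c : E3) {R : ℝ} (hR : 0 < R) :
    Summable fun p : Sites₀ (anchorDatum t τ) A => ∑' q : Sites₀ (anchorDatum t τ) A,
        secK (p - q) (vField t A τ u p - vField t A τ u q) (vField t A τ u p - vField t A τ u q)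
          (cutoff (Sites₀ (anchorDatum t τ) A) c R q ^ 2 • vField t A τ u q) :=
  (summable_sum fun q _ => summable_first_col hA hI hIτ hu c R q).congr fun p =>
    (first_row_eq_sum (u := u) hA hIτ c hR p).symm

/-! ## The row identity -/

/-- **The cut-off identity summed over a row** (`p ∈ S*`):
`Σ_q B_pq(D(χv), D(χv)) = −Σ_q B_pq(Dv, χ_q² v_q) + Σ_q (χ_p − χ_q)² B_pq(v_p, v_q)`. [folklore] -/
theorem row_identity (hA : Adm₀ A) (hI : Inner₀ t A) (hIτ : Inner₀ (anchorDatum t τ) A)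
    (hu : IsDisplacement X t A u) (hEX : Equil₀ X) (hEτ : Equil₀ (Sites₀ (anchorDatum t τ) A))
    (c : E3) (R : ℝ) {p : E3} (hp : p ∈ Sites₀ (anchorDatum t τ) A) :
    ∑' q : Sites₀ (anchorDatum t τ) A,
        secK (p - q) (vField t A τ u p - vField t A τ u q)
          (cutoff (Sites₀ (anchorDatum t τ) A) c R p • vField t A τ u p -
            cutoff (Sites₀ (anchorDatum t τ) A) c R q • vField t A τ u q)
          (cutoff (Sites₀ (anchorDatum t τ) A) c R p • vField t A τ u p -
            cutoff (Sites₀ (anchorDatum t τ) A) c R q • vField t A τ u q) =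
      -(∑' q : Sites₀ (anchorDatum t τ) A,
          secK (p - q) (vField t A τ u p - vField t A τ u q) (vField t A τ u p - vField t A τ u q)
            (cutoff (Sites₀ (anchorDatum t τ) A) c R q ^ 2 • vField t A τ u q)) +
        ∑' q : Sites₀ (anchorDatum t τ) A,
          (cutoff (Sites₀ (anchorDatum t τ) A) c R p - cutoff (Sites₀ (anchorDatum t τ) A) c R q) ^ 2 *
            secK (p - q) (vField t A τ u p - vField t A τ u q) (vField t A τ u p) (vField t A τ u q) := by
  set S' := Sites₀ (anchorDatum t τ) A with hS'
  set v := vField t A τ u with hv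
  set χ := cutoff S' c R with hχ
  have h1 : Summable fun q : S' => secK (p - q) (v p - v q) (v p - v q) (χ p ^ 2 • v p) :=
    summable_row hA hI hIτ hu hp (fun q => v p - v q) (fun _ => χ p ^ 2 • v p)
      (fun q => norm_vField_sub_le hA hI hIτ hu hp q.2) (fun _ => norm_sq_cutoff_smul_le hA hI hIτ hu c R ⟨p, hp⟩)
  have h2 : Summable fun q : S' => secK (p - q) (v p - v q) (v p - v q) (χ q ^ 2 • v q) :=
    summable_row hA hI hIτ hu hp (fun q => v p - v q) (fun q => χ q ^ 2 • v q)
      (fun q => norm_vField_sub_le hA hI hIτ hu hp q.2) (fun q => norm_sq_cutoff_smul_le hA hI hIτ hu c R q)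
  have h3 : Summable fun q : S' => (χ p - χ q) ^ 2 * secK (p - q) (v p - v q) (v p) (v q) := by
    have h := summable_row hA hI hIτ hu hp (fun q => (χ p - χ q) ^ 2 • v p) (fun q => v q) (c := 3 / 40)
      (c' := 3 / 40) ?_ (fun q => norm_vField_le hA hI hIτ hu q.2)
    · refine h.congr fun q => ?_
      exact secK_smul_left _ _ _ _ _
    · intro q
      rw [norm_smul, Real.norm_eq_abs, abs_of_nonneg (sq_nonneg _)]
      calc (χ p - χ q) ^ 2 * ‖v p‖ ≤ 1 * (3 / 40) :=
          mul_le_mul (sq_cutoff_sub_le_one S' c R p q) (norm_vField_le hA hI hIτ hu hp) (norm_nonneg _) zero_le_one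
        _ = 3 / 40 := one_mul _
  have hpt : ∀ q : S', secK (p - q) (v p - v q) (χ p • v p - χ q • v q) (χ p • v p - χ q • v q) =
      (secK (p - q) (v p - v q) (v p - v q) (χ p ^ 2 • v p) - secK (p - q) (v p - v q) (v p - v q) (χ q ^ 2 • v q)) +
        (χ p - χ q) ^ 2 * secK (p - q) (v p - v q) (v p) (v q) := by
    intro q
    rw [B_cutoff_identity hA hI hIτ hu hp q.2 (χ p) (χ q) (v p) (v q) (fun h => by rw [h]),
      B_sub_right hA hI hIτ hu hp q.2]
  rw [tsum_congr hpt, Summable.tsum_add (h1.sub h2) h3, Summable.tsum_sub h1 h2,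
    tsum_linear_eq hA hI hIτ hu hEX hEτ hp, zero_sub]

/-! ## The second part: the kernel energy of the cut-off -/

/-- **Row bound for the second part**: `|Σ_q (χ_p − χ_q)² B_pq(v_p, v_q)| ≤ (3/40)²·Σ_q (χ_p − χ_q)² k(p,q)`.
[folklore] -/
theorem abs_T_le (hA : Adm₀ A) (hI : Inner₀ t A) (hIτ : Inner₀ (anchorDatum t τ) A)
    (hu : IsDisplacement X t A u) (c : E3) (R : ℝ) {p : E3} (hp : p ∈ Sites₀ (anchorDatum t τ) A) :
    |∑' q : Sites₀ (anchorDatum t τ) A,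
        (cutoff (Sites₀ (anchorDatum t τ) A) c R p - cutoff (Sites₀ (anchorDatum t τ) A) c R q) ^ 2 *
          secK (p - q) (vField t A τ u p - vField t A τ u q) (vField t A τ u p) (vField t A τ u q)| ≤
      (3 / 40) ^ 2 * ∑' q : Sites₀ (anchorDatum t τ) A,
        (cutoff (Sites₀ (anchorDatum t τ) A) c R p - cutoff (Sites₀ (anchorDatum t τ) A) c R q) ^ 2 * ker p q := by
  rw [← tsum_mul_left, ← Real.norm_eq_abs]
  refine tsum_of_norm_bounded ((summable_weight hA hIτ c R hp).mul_left _).hasSum fun q => ?_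
  rw [Real.norm_eq_abs, abs_mul, abs_of_nonneg (sq_nonneg _)]
  have hB := abs_B_le hA hI hIτ hu hp q.2 (vField t A τ u p) (vField t A τ u q)
  have hvp := norm_vField_le hA hI hIτ hu hp
  have hvq := norm_vField_le hA hI hIτ hu q.2
  have hk := ker_nonneg p q
  have hk' : 0 ≤ ker p q * (3 / 40) := by positivity
  calc (cutoff (Sites₀ (anchorDatum t τ) A) c R p - cutoff (Sites₀ (anchorDatum t τ) A) c R q) ^ 2 *
        |secK (p - q) (vField t A τ u p - vField t A τ u q) (vField t A τ u p) (vField t A τ u q)|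
      ≤ (cutoff (Sites₀ (anchorDatum t τ) A) c R p - cutoff (Sites₀ (anchorDatum t τ) A) c R q) ^ 2 *
          (ker p q * ‖vField t A τ u p‖ * ‖vField t A τ u q‖) := mul_le_mul_of_nonneg_left hB (sq_nonneg _)
    _ ≤ (cutoff (Sites₀ (anchorDatum t τ) A) c R p - cutoff (Sites₀ (anchorDatum t τ) A) c R q) ^ 2 *
          (ker p q * (3 / 40) * (3 / 40)) := by gcongr
    _ = (3 / 40) ^ 2 * ((cutoff (Sites₀ (anchorDatum t τ) A) c R p - cutoff (Sites₀ (anchorDatum t τ) A) c R q) ^ 2 *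
          ker p q) := by ring

/-- The second part, row by row, is a summable family of `p` (dominated by `K₀` on `B_{3R}(c)` and by finitely
many kernel columns off it). [folklore] -/
theorem summable_T (hA : Adm₀ A) (hI : Inner₀ t A) (hIτ : Inner₀ (anchorDatum t τ) A)
    (hu : IsDisplacement X t A u) (c : E3) {R : ℝ} (hR : 0 < R) :
    Summable fun p : Sites₀ (anchorDatum t τ) A => ∑' q : Sites₀ (anchorDatum t τ) A,
        (cutoff (Sites₀ (anchorDatum t τ) A) c R p - cutoff (Sites₀ (anchorDatum t τ) A) c R q) ^ 2 *
          secK (p - q) (vField t A τ u p - vField t A τ u q) (vField t A τ u p) (vField t A τ u q) := by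
  set P := (finite_sites_ball hA hIτ c (2 * R)).toFinset with hP
  set P₃ := (finite_sites_ball hA hIτ c (3 * R)).toFinset with hP₃
  have hmemP₃ : ∀ q : Sites₀ (anchorDatum t τ) A, q ∈ P₃ ↔ dist (q : E3) c ≤ 3 * R := fun q => by
    rw [hP₃, Set.Finite.mem_toFinset]; rfl
  set g : Sites₀ (anchorDatum t τ) A → ℝ := fun p =>
    (3 / 40) ^ 2 * ((if p ∈ P₃ then K₀ else 0) + ∑ q ∈ P, ker (q : E3) p) with hg
  have hg1 : Summable fun p : Sites₀ (anchorDatum t τ) A => (if p ∈ P₃ then K₀ else 0) :=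
    summable_of_ne_finset_zero (s := P₃) fun p hp => if_neg hp
  have hg2 : Summable fun p : Sites₀ (anchorDatum t τ) A => ∑ q ∈ P, ker (q : E3) p :=
    summable_sum fun q _ => summable_ker hA hIτ q.2
  have hgs : Summable g := (hg1.add hg2).mul_left _
  refine Summable.of_norm_bounded hgs fun p => ?_
  rw [Real.norm_eq_abs]
  refine (abs_T_le hA hI hIτ hu c R p.2).trans ?_
  refine mul_le_mul_of_nonneg_left ?_ (by norm_num)
  by_cases h3 : p ∈ P₃
  · rw [if_pos h3]
    have h1 := tsum_weight_le_K₀ hA hIτ c R p.2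
    have h2 : 0 ≤ ∑ q ∈ P, ker (q : E3) p := Finset.sum_nonneg fun q _ => ker_nonneg _ _
    linarith
  · rw [if_neg h3, zero_add]
    have hpc : 3 * R < dist (p : E3) c := not_le.1 fun h => h3 ((hmemP₃ p).2 h)
    refine (tsum_weight_far_le hA hIτ c hR hpc).trans ?_
    exact Finset.sum_le_sum fun q _ => by split_ifs; exacts [le_rfl, ker_nonneg _ _]

/-- **The second part is `≤ (3/40)²·1984·K₀·R`** (`R ≥ 1`). [folklore] -/
theorem tsum_T_le (hA : Adm₀ A) (hI : Inner₀ t A) (hIτ : Inner₀ (anchorDatum t τ) A)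
    (hu : IsDisplacement X t A u) (c : E3) {R : ℝ} (hR : 1 ≤ R) :
    ∑' p : Sites₀ (anchorDatum t τ) A, ∑' q : Sites₀ (anchorDatum t τ) A,
        (cutoff (Sites₀ (anchorDatum t τ) A) c R p - cutoff (Sites₀ (anchorDatum t τ) A) c R q) ^ 2 *
          secK (p - q) (vField t A τ u p - vField t A τ u q) (vField t A τ u p) (vField t A τ u q) ≤
      (3 / 40) ^ 2 * (1984 * K₀ * R) := by
  refine (summable_T hA hI hIτ hu c (by linarith)).tsum_le_of_sum_le fun F => ?_
  calc ∑ p ∈ F, ∑' q : Sites₀ (anchorDatum t τ) A,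
        (cutoff (Sites₀ (anchorDatum t τ) A) c R p - cutoff (Sites₀ (anchorDatum t τ) A) c R q) ^ 2 *
          secK (p - q) (vField t A τ u p - vField t A τ u q) (vField t A τ u p) (vField t A τ u q)
      ≤ ∑ p ∈ F, (3 / 40) ^ 2 * ∑' q : Sites₀ (anchorDatum t τ) A,
          (cutoff (Sites₀ (anchorDatum t τ) A) c R p - cutoff (Sites₀ (anchorDatum t τ) A) c R q) ^ 2 * ker p q :=
        Finset.sum_le_sum fun p _ => (le_abs_self _).trans (abs_T_le hA hI hIτ hu c R p.2)
    _ = (3 / 40) ^ 2 * ∑ p ∈ F, ∑' q : Sites₀ (anchorDatum t τ) A,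
          (cutoff (Sites₀ (anchorDatum t τ) A) c R p - cutoff (Sites₀ (anchorDatum t τ) A) c R q) ^ 2 * ker p q := by
        rw [Finset.mul_sum]
    _ ≤ (3 / 40) ^ 2 * (1984 * K₀ * R) :=
        mul_le_mul_of_nonneg_left (sum_tsum_weight_le hA hIτ c hR F) (by norm_num)

/-! ## The nonlinear Caccioppoli inequality -/

/-- **Nonlinear Caccioppoli inequality (secant form)**: for `R ≥ 1` and every centre `c`,
`secFormAt (anchorDatum t τ) A v (χ•v) ≤ (3/40)²·1984·K₀·R` with `χ = cutoff S* c R`. [folklore] -/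
theorem secFormAt_cutoff_le (hA : Adm₀ A) (hI : Inner₀ t A) (hIτ : Inner₀ (anchorDatum t τ) A)
    (hu : IsDisplacement X t A u) (hEX : Equil₀ X) (hEτ : Equil₀ (Sites₀ (anchorDatum t τ) A))
    (c : E3) {R : ℝ} (hR : 1 ≤ R) :
    secFormAt (anchorDatum t τ) A (vField t A τ u)
        (fun p => cutoff (Sites₀ (anchorDatum t τ) A) c R p • vField t A τ u p) ≤
      (3 / 40) ^ 2 * (1984 * K₀ * R) := by
  have hR0 : 0 < R := by linarith
  rw [secFormAt_eq_tsum hA hI hIτ hu]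
  have hrows : ∀ p : Sites₀ (anchorDatum t τ) A,
      ∑' q : Sites₀ (anchorDatum t τ) A, secK (p - q) (vField t A τ u p - vField t A τ u q)
        ((fun x => cutoff (Sites₀ (anchorDatum t τ) A) c R x • vField t A τ u x) p -
          (fun x => cutoff (Sites₀ (anchorDatum t τ) A) c R x • vField t A τ u x) q)
        ((fun x => cutoff (Sites₀ (anchorDatum t τ) A) c R x • vField t A τ u x) p -
          (fun x => cutoff (Sites₀ (anchorDatum t τ) A) c R x • vField t A τ u x) q) =
      -(∑' q : Sites₀ (anchorDatum t τ) A,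
          secK (p - q) (vField t A τ u p - vField t A τ u q) (vField t A τ u p - vField t A τ u q)
            (cutoff (Sites₀ (anchorDatum t τ) A) c R q ^ 2 • vField t A τ u q)) +
        ∑' q : Sites₀ (anchorDatum t τ) A,
          (cutoff (Sites₀ (anchorDatum t τ) A) c R p - cutoff (Sites₀ (anchorDatum t τ) A) c R q) ^ 2 *
            secK (p - q) (vField t A τ u p - vField t A τ u q) (vField t A τ u p) (vField t A τ u q) :=
    fun p => row_identity hA hI hIτ hu hEX hEτ c R p.2
  rw [tsum_congr hrows, Summable.tsum_add (summable_first_part hA hI hIτ hu c hR0).neg (summable_T hA hI hIτ hu c hR0),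
    tsum_neg, tsum_first_part_eq_zero hA hI hIτ hu hEX hEτ c hR0, neg_zero, zero_add]
  exact tsum_T_le hA hI hIτ hu c hR

/-! ## The test field `χ•v` is admissible for the coercivity hypothesis -/

/-- The test field `χ•v` is finitely supported inside the anchored sites. [folklore] -/
theorem support_cutoff_smul (hA : Adm₀ A) (hIτ : Inner₀ (anchorDatum t τ) A) (c : E3) {R : ℝ} (hR : 0 < R)
    (u : E3 → E3) :
    (Function.support fun p => cutoff (Sites₀ (anchorDatum t τ) A) c R p • vField t A τ u p).Finite ∧
      (Function.support fun p => cutoff (Sites₀ (anchorDatum t τ) A) c R p • vField t A τ u p) ⊆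
        Sites₀ (anchorDatum t τ) A := by
  have hsub : (Function.support fun p => cutoff (Sites₀ (anchorDatum t τ) A) c R p • vField t A τ u p) ⊆
      {s | s ∈ Sites₀ (anchorDatum t τ) A ∧ dist s c ≤ 2 * R} := by
    intro p hp
    rw [Function.mem_support] at hp
    have hχ : cutoff (Sites₀ (anchorDatum t τ) A) c R p ≠ 0 := fun h => hp (by rw [h, zero_smul])
    obtain ⟨hpS, hd⟩ := mem_of_cutoff_ne_zero hR hχ
    exact ⟨hpS, hd.le⟩
  exact ⟨(finite_sites_dist_le hA hIτ c (2 * R)).subset hsub, fun p hp => (hsub hp).1⟩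

/-- **Coercivity applied to the cut-off field**: `κ₁·nnForm (anchorDatum t τ) A (χ•v) ≤ C₀R/2`. [folklore] -/
theorem nnForm_cutoff_le {ρ κ₁ : ℝ} (hSC : SecantCoercive ρ κ₁) (hA : Adm₀ A) (hI : Inner₀ t A) (hρ : ‖τ‖ ≤ ρ)
    (hIτ : Inner₀ (anchorDatum t τ) A) (hEτ : Equil₀ (Sites₀ (anchorDatum t τ) A))
    (hu : IsDisplacement X t A u) (hEX : Equil₀ X) (c : E3) {R : ℝ} (hR : 1 ≤ R) :
    κ₁ * nnForm (anchorDatum t τ) A (fun p => cutoff (Sites₀ (anchorDatum t τ) A) c R p • vField t A τ u p) ≤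
      (3 / 40) ^ 2 * (1984 * K₀ * R) / 2 := by
  have hbox : ∀ s ∈ Sites₀ (anchorDatum t τ) A, ‖vField t A τ u s + shiftField (anchorDatum t τ) A τ s‖ ≤ 1 / 40 :=
    fun s hs => by rw [vField_add_shiftField]; exact hu.1 _ (bwd_mem hA hIτ hs)
  obtain ⟨hfin, hsub⟩ := support_cutoff_smul hA hIτ c (by linarith : (0 : ℝ) < R) u
  have h := hSC t A τ hA hI hρ hIτ hEτ (vField t A τ u) hbox _ hfin hsub
  have h2 := secFormAt_cutoff_le hA hI hIτ hu hEX hEτ c hR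
  have h3 := div_le_div_of_nonneg_right h2 (by norm_num : (0 : ℝ) ≤ 2)
  exact h.trans h3

end LevelOne

/-- **Stub `stub_levelOneGrowth` (line `Sketch`, crux `HcpLiouville`)**: level 1 of the two-level Caccioppoli
argument — under ray-secant coercivity, the nearest-neighbour strain energy of `u − τ𝟙₁` grows at most
linearly with the radius. [folklore] -/
theorem stub_levelOneGrowth : ∀ ρ κ₁ : ℝ, 0 < κ₁ → SecantCoercive ρ κ₁ → ∀ (X : Set E3) (t : Fin 2 → E3) (A : E3 →L[ℝ] E3) (u : E3 → E3) (τ : E3), Adm₀ A → Inner₀ t A → Equil₀ X → IsDisplacement X t A u → ‖τ‖ ≤ ρ → Inner₀ (anchorDatum t τ) A → Equil₀ (Sites₀ (anchorDatum t τ) A) → GrowthBound t A (fun s => u s - shiftField t A τ s) := by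
  intro ρ κ₁ hκ₁ hSC X t A u τ hA hI hEX hu hρ hIτ hEτ
  refine ⟨(3 / 40) ^ 2 * (1984 * LevelOne.K₀) * 2 / κ₁, fun c R hR => ?_⟩
  have hR3 : (0 : ℝ) < R + 3 := by linarith
  have h1 := LevelOne.growth_sum_le_nnForm hA hI hIτ u
    (fun p => LevelOne.cutoff (Sites₀ (anchorDatum t τ) A) c (R + 3) p • LevelOne.vField t A τ u p) c
    (R'' := 2 * (R + 3)) (by linarith : R + 23 / 20 ≤ R + 3)
    (fun p hp hd => by simp only [LevelOne.cutoff_eq_one hR3 hp hd, one_smul])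
    (fun p _ hd => by simp only [LevelOne.cutoff_eq_zero_of_le hR3 hd, zero_smul])
  have h2 := LevelOne.nnForm_cutoff_le hSC hA hI hρ hIτ hEτ hu hEX c (by linarith : (1 : ℝ) ≤ R + 3)
  have hK : 0 ≤ (3 / 40 : ℝ) ^ 2 * (1984 * LevelOne.K₀) := by
    have := LevelOne.K₀_pos; positivity
  set N := nnForm (anchorDatum t τ) A
    (fun p => LevelOne.cutoff (Sites₀ (anchorDatum t τ) A) c (R + 3) p • LevelOne.vField t A τ u p) with hN
  have h3 : κ₁ * N ≤ 2 * ((3 / 40 : ℝ) ^ 2 * (1984 * LevelOne.K₀)) * R := by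
    have : (3 / 40 : ℝ) ^ 2 * (1984 * LevelOne.K₀ * (R + 3)) / 2 ≤ 2 * ((3 / 40 : ℝ) ^ 2 * (1984 * LevelOne.K₀)) * R := by
      nlinarith
    exact h2.trans this
  have h4 : N ≤ (3 / 40) ^ 2 * (1984 * LevelOne.K₀) * 2 / κ₁ * R := by
    rw [div_mul_eq_mul_div, le_div_iff₀ hκ₁]
    linarith
  exact h1.trans h4

end Summit.AtomisticToContinuum.Crystallization.Theorems.ExcessDecayLiouville

end
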